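import Summits.Ventures.PercRepro.PerFlatHall
import Summits.Ventures.PercRepro.SixThreeFinal

/-!
# PercRepro — the Hall form of C-025 (C-029) at `(6, 3)` on the core, in the kernel (night-4, gen 2)

The cell's `(6, 3)` chain (p2 / p3 / p5: the soft max-trace rule `fRule M P S = 6^{|S ∩ P| − 3}` on the planes `P`
with `ρ(S ∩ P) = 3`, Theorem P₁ `P1.supply_ge_three`, the profile tables of `SixThreeDischarge`) proves the per-plane
inequality `3 · #U_G ≤ Σ_S fRule(G, S)/D(S)` on every plane of a simple matroid of rank `≥ 6` — inline, inside
`c025_six_three_of_P1` (the coloop hypothesis of the frame is not used by the per-plane chain).  This file EXPOSES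
it (`perPlane_six_three_core`) and, since the rule
vanishes off adjacency by its own `if`, feeds it to `hall_of_cert`: **`hall_six_three_core`**, C-029 at `(6, 3)` on
every simple matroid of rank `≥ 6`.  Imports `PerFlatHall` and `SixThreeFinal` (the landed `(6, 3)` chain).
-/

namespace PercRepro.PerFlat

open Finset ThmH SixThree

/-- **The `(6, 3)` per-plane inequality of the soft max-trace rule on the core, unconditional** (the composition of
`perPlane_small_of_planar` over the profile tables and `perPlane_of_six_le` over Theorem P₁). -/
theorem perPlane_six_three_core {α : Type} [DecidableEq α] {M : Matroid α} [M.Finite] (hs : Simple M)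
    (hge : (6 : ℕ∞) ≤ M.eRank) {G : Finset α} (hG : G ∈ planes M) :
    (3 : ℚ) * ((UqG M 6 3 G).card : ℚ) ≤ ∑ S ∈ Yq M 6 3, fRule M G S / D M S := by
  by_cases hW : M.eRk ((gr M \ G : Finset α) : Set α) ≤ 5
  · have hI : PlanarIneqs M G := by
      have hg3 : 3 ≤ G.card := three_le_card_of_eRk_eq_three (mem_planes.1 hG).2.2
      rcases Nat.eq_or_lt_of_le hg3 with h3' | hg4
      · exact planarIneqs_of_three_points hG h3'.symm
      · rcases Nat.eq_or_lt_of_le hg4 with h4' | hg5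
        · exact planarIneqs_of_table hs hG hg4
            (tableIneq12_of_add hs hG (tableIneqAdd12_of_four hs hG h4'.symm))
            (fun _ => planarIneq3_of_four h4'.symm)
        · exact planarIneqs_of_table hs hG hg4
            (tableIneq12_of_add hs hG (tableIneqAdd12_of_plane hs hG hg5))
            (fun _ => planarIneq3_of_table hs hG hg4 (type3_general_of_plane hs hG hg5)
              (fun L₁ L₂ h12 _ hnl => type3_twoLines_of_plane hs hG hg5 L₁ L₂ h12 hnl))
    exact perPlane_small_of_planar hs hG hge hW hI
  · push Not at hW
    exact perPlane_of_six_le hs hG (Order.add_one_le_of_lt hW) (P1.supply_ge_three hs hG)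

/-- The soft max-trace rule vanishes off adjacency (its defining condition is `ρ(S ∩ P) = 3`). -/
theorem fRule_eq_zero_of_not_adj {α : Type} [DecidableEq α] {M : Matroid α} [M.Finite] {P S : Finset α}
    (h : ¬ Adj M 3 P S) : fRule M P S = 0 := by
  unfold fRule
  rw [if_neg]
  intro h3
  apply h
  unfold Adj
  rw [h3]
  rfl

/-- **C-029 at `(6, 3)` on every simple matroid of rank `≥ 6`**: `Hall M 6 3 (Φ(6, 3))` (no coloop hypothesis is
needed: the `(6, 3)` per-plane chain never uses it). -/
theorem hall_six_three_core {α : Type} [DecidableEq α] {M : Matroid α} [M.Finite] (hs : Simple M)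
    (hge : (6 : ℕ∞) ≤ M.eRank) : Hall M 6 3 (phiK 6 3) := by
  rw [phiK_six_three']
  apply hall_of_cert (by norm_num) (w := fun G S => fRule M G S / D M S)
  refine ⟨fun G S => div_nonneg (fRule_nonneg M G S) (Finset.sum_nonneg (fun P _ => fRule_nonneg M P S)),
    fun G _ S h => by rw [fRule_eq_zero_of_not_adj h, zero_div], ?_, ?_⟩
  · intro S _
    have := sum_normalized_le_one (M := M) 3 (fRule M) (fRule_nonneg M) S
    rw [flatsQ_three] at this
    exact this
  · intro G hG
    rw [flatsQ_three] at hG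
    exact perPlane_six_three_core hs hge hG

end PercRepro.PerFlat
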